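import Mathlib.RingTheory.Etale.StandardEtale
import HarnessLib

/-!
# Étale pairs without monicity: the étale algebra `R[X][Y]/⟨f, Yg − 1⟩` for any `f`

Topic: `Literature/AlgebraicGeometry/Resolution`. A technical tool for the algebraic proof of
Temkin's decompletion lemma (M. Temkin, *Inseparable local uniformization*, J. Algebra 373
(2013) 65–119 = arXiv:0804.1554v3, Lemma 3.3.2; tree: `Temkin2013_Lemma332_nft`,
`InseparableLocalUniformizationDecompletion.lean`), where two explicit étale charts are needed
whose defining polynomial is NOT monic (a "zoomed" Hensel equation `Z + π·(…) = 0` over a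
normalized model, and a zoomed implicit-function equation over a polynomial ring over a
valuation ring).

Mathlib's `StandardEtalePair R` is a pair `(f, g)` of polynomials with `f` MONIC and
`f′ p₁ + f p₂ = gⁿ`; its ring `R[X][Y]/⟨f, Yg − 1⟩ ≅ (R[X]/f)[1/g]` is étale. As the Mathlib
source itself remarks ("This works even if `f` is not monic. Generalize if we care."), the proof
of formal étaleness never uses monicity: `R[X][Y]/⟨f, Yg − 1⟩` is the standard smooth algebra
of relative dimension `0` with generators `X, Y`, relations `f, Yg − 1` and Jacobian `f′·g`
(The Stacks Project, Tag 00T6 (standard smooth), Tag 00TA, and Tag 00U9: "`R → R[x]_g/(f)` is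
étale if the image of `f′` is invertible in `R[x]_g/(f)`" is stated there for `f` monic, Tag
00UB; the non-monic case is Tag 00T7 with `n = c = 1`). This file carries out that
generalization, copying Mathlib's treatment with the field `monic_f` dropped:

* `EtalePair R` — a pair `f g : R[X]` with `∃ p₁ p₂ n, f′ p₁ + f p₂ = gⁿ` (no monicity).
* `EtalePair.Ring P = R[X][Y] ⧸ ⟨C f, Y·C g − 1⟩`, with `P.X`, `P.HasMap`, `P.lift`, `P.hom_ext`,
  `P.homEquiv` (maps out of `P.Ring` ↔ elements `x` with `f(x) = 0`, `g(x)` a unit) — PROVED.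
* `Algebra.FormallyEtale R P.Ring`, `Algebra.Etale R P.Ring` (hence `Algebra.Smooth`) — PROVED.
* Constructors `EtalePair.ofDerivative f` (`g = f′`) and `EtalePair.ofDerivativeMul f q`
  (`g = f′·q`: localize simultaneously away from `q`) — PROVED.

Everything is [folklore] (Stacks Tags 00T7/00U9); the code follows
`Mathlib/RingTheory/Etale/StandardEtale.lean` (A. Yang) closely.

## Sources

* The Stacks Project, Tag 00T6, Tag 00T7, Tag 00U9 (`R[x]_g/(f)` with `f′` invertible).
* M. Temkin, arXiv:0804.1554v3, Lemma 3.3.2 (the application).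
-/

noncomputable section

open Polynomial

open scoped Bivariate

namespace Literature.AlgebraicGeometry.Resolution

universe u

variable {R S T : Type*} [CommRing R] [CommRing S] [CommRing T] [Algebra R S] [Algebra R T]

variable (R) in
/-- An `EtalePair R` is a pair `f g : R[X]` such that `f′` is invertible in `R[X][1/g]/f`,
witnessed by `f′ p₁ + f p₂ = gⁿ`. Unlike Mathlib's `StandardEtalePair`, `f` need NOT be monic
(Stacks Project, Tag 00T7 with one variable and one relation). [folklore] -/
structure EtalePair : Type _ where
  /-- The polynomial to be quotiented out. -/
  f : R[X]
  /-- The polynomial to be localized away from. -/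
  g : R[X]
  /-- `f′` is invertible in `R[X][1/g]/f`. -/
  cond : ∃ p₁ p₂ n, derivative f * p₁ + f * p₂ = g ^ n

namespace EtalePair

variable (P : EtalePair R)

/-- The étale algebra `R[X][Y]/⟨f, Yg − 1⟩ ≅ (R[X]/f)[1/g]` of an `EtalePair`. [folklore] -/
protected def Ring : Type _ := R[X][Y] ⧸ Ideal.span {C P.f, Y * C P.g - 1}

/-- Ring structure on `P.Ring` (a quotient of `R[X][Y]`). [folklore] -/
instance instCommRing : CommRing P.Ring :=
  inferInstanceAs (CommRing (R[X][Y] ⧸ Ideal.span {C P.f, Y * C P.g - 1}))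

/-- `R`-algebra structure on `P.Ring`. [folklore] -/
instance instAlgebra : Algebra R P.Ring :=
  inferInstanceAs (Algebra R (R[X][Y] ⧸ Ideal.span {C P.f, Y * C P.g - 1}))

/-- The quotient map `R[X][Y] → P.Ring`, as an `R`-algebra map. [folklore] -/
def proj : R[X][Y] →ₐ[R] P.Ring :=
  Ideal.Quotient.mkₐ R (Ideal.span {C P.f, Y * C P.g - 1})

/-- The quotient map is surjective. [folklore] -/
theorem proj_surjective : Function.Surjective P.proj :=
  Ideal.Quotient.mk_surjective

/-- The class of `X` in `R[X][Y]/⟨f, Yg − 1⟩`. [folklore] -/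
protected def X : P.Ring := P.proj (C .X)

/-- The class of `Y` (the inverse of `g(X)`) in `R[X][Y]/⟨f, Yg − 1⟩`. [folklore] -/
def invG : P.Ring := P.proj Y

/-- There is a map `R[X][Y]/⟨f, Yg − 1⟩ → S` sending `X` to `x` iff `f(x) = 0` and `g(x)` is
invertible. [folklore] -/
def HasMap (x : S) : Prop :=
  aeval x P.f = 0 ∧ IsUnit (aeval x P.g)

/-- `proj` is `Ideal.Quotient.mk`. [folklore] -/
theorem proj_apply (q : R[X][Y]) :
    P.proj q = Ideal.Quotient.mk (Ideal.span {C P.f, Y * C P.g - 1}) q := rfl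

/-- `f = 0` in `P.Ring`. [folklore] -/
theorem proj_C_f : P.proj (C P.f) = 0 := by
  rw [proj_apply]
  exact Ideal.Quotient.eq_zero_iff_mem.mpr (Ideal.subset_span (Set.mem_insert _ _))

/-- `Y·g = 1` in `P.Ring`. [folklore] -/
theorem proj_Y_mul_C_g : P.proj Y * P.proj (C P.g) = 1 := by
  rw [← map_mul, ← map_one P.proj, ← sub_eq_zero, ← map_sub, proj_apply]
  exact Ideal.Quotient.eq_zero_iff_mem.mpr (Ideal.subset_span (Set.mem_insert_of_mem _ rfl))

/-- `aeval P.X` on `R[X]` is `mk ∘ C`. [folklore] -/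
theorem aeval_X_eq : aeval (R := R) P.X = P.proj.comp Polynomial.CAlgHom := by
  refine Polynomial.algHom_ext ?_
  simp [EtalePair.X]

/-- Evaluating a polynomial at `P.X` is the class of its constant-in-`Y` lift. [folklore] -/
theorem aeval_X_apply (p : R[X]) : aeval P.X p = P.proj (C p) := by
  rw [aeval_X_eq]; rfl

/-- `P.X` satisfies `f(X) = 0`, `g(X)` invertible (with inverse `Y`). [folklore] -/
theorem hasMap_X : P.HasMap P.X :=
  ⟨by rw [aeval_X_apply, proj_C_f],
    IsUnit.of_mul_eq_one P.invG (by rw [aeval_X_apply, mul_comm]; exact P.proj_Y_mul_C_g)⟩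

variable {P} in
/-- `HasMap` is preserved by algebra maps. [folklore] -/
theorem HasMap.map {x : S} (h : P.HasMap x) (φ : S →ₐ[R] T) : P.HasMap (φ x) :=
  ⟨by simp [aeval_algHom, h.1], by simpa [aeval_algHom] using h.2.map φ⟩

variable {P} in
/-- If `f(x) = 0` and `g(x)` is a unit then `f′(x)` is a unit. [folklore] -/
theorem HasMap.isUnit_derivative_f {x : S} (h : P.HasMap x) :
    IsUnit (aeval x (derivative P.f)) := by
  obtain ⟨p₁, p₂, n, e⟩ := P.cond
  have : aeval x (derivative P.f) ∣ aeval x P.g ^ n :=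
    ⟨_, by simpa [h.1] using congr(aeval x $e.symm)⟩
  exact isUnit_of_dvd_unit this (.pow _ h.2)

/-- The map `R[X][Y]/⟨f, Yg − 1⟩ →ₐ[R] S` sending `X ↦ x`, `Y ↦ g(x)⁻¹`, given `P.HasMap x`.
[folklore] -/
def lift (x : S) (h : P.HasMap x) : P.Ring →ₐ[R] S :=
  Ideal.Quotient.liftₐ _ (aevalAeval x ↑(h.2.unit⁻¹))
    (Ideal.span_le (I := RingHom.ker _).mpr (by simp [Set.pair_subset_iff, h.1]))

/-- `lift` on representatives is two-variable evaluation at `(x, g(x)⁻¹)`. [folklore] -/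
theorem lift_proj (x : S) (h : P.HasMap x) (q : R[X][Y]) :
    P.lift x h (P.proj q) = aevalAeval x ↑(h.2.unit⁻¹) q := rfl

/-- `lift` sends `X ↦ x`. [folklore] -/
@[simp]
theorem lift_X (x : S) (h : P.HasMap x) : P.lift x h P.X = x := by
  rw [EtalePair.X, lift_proj, aevalAeval_X]

/-- `lift` sends `Y ↦ g(x)⁻¹`. [folklore] -/
@[simp]
theorem lift_invG (x : S) (h : P.HasMap x) : P.lift x h P.invG = ↑(h.2.unit⁻¹) := by
  rw [invG, lift_proj, aevalAeval_Y]

/-- `Y` is the inverse of `g(X)` in `P.Ring`. [folklore] -/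
theorem invG_eq_inv : P.invG = ↑(P.hasMap_X.2.unit⁻¹) := by
  refine (Units.mul_eq_one_iff_inv_eq.mp ?_).symm
  rw [IsUnit.unit_spec, aeval_X_apply, mul_comm]
  exact P.proj_Y_mul_C_g

variable {P} in
/-- Algebra maps out of `P.Ring` are determined by the image of `X`. [folklore] -/
@[ext]
theorem hom_ext {φ ψ : P.Ring →ₐ[R] S} (H : φ P.X = ψ P.X) : φ = ψ := by
  have hg : φ (aeval P.X P.g) = ψ (aeval P.X P.g) := by
    rw [← aeval_algHom_apply, ← aeval_algHom_apply, H]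
  have hY : φ P.invG = ψ P.invG := by
    -- `invG` is the inverse of `g(X)`; ring maps preserve inverses of units
    have hinv : P.invG * aeval P.X P.g = 1 := by
      rw [aeval_X_apply]; exact P.proj_Y_mul_C_g
    have h1 : φ P.invG * φ (aeval P.X P.g) = 1 := by rw [← map_mul, hinv, map_one]
    have h2 : ψ P.invG * ψ (aeval P.X P.g) = 1 := by rw [← map_mul, hinv, map_one]
    rw [hg] at h1
    calc φ P.invG = φ P.invG * (ψ (aeval P.X P.g) * ψ P.invG) := by
          rw [mul_comm (ψ _) (ψ P.invG), h2, mul_one]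
      _ = (φ P.invG * ψ (aeval P.X P.g)) * ψ P.invG := by rw [mul_assoc]
      _ = ψ P.invG := by rw [h1, one_mul]
  have key : φ.comp P.proj = ψ.comp P.proj := by
    refine Polynomial.algHom_ext' (Polynomial.algHom_ext ?_) ?_
    · simpa [EtalePair.X] using H
    · simpa [invG] using hY
  refine AlgHom.ext fun z => ?_
  obtain ⟨q, rfl⟩ := P.proj_surjective z
  exact congr($key q)

/-- Lifting along `P.X` itself is the identity. [folklore] -/
@[simp]
theorem lift_X_left : P.lift P.X P.hasMap_X = AlgHom.id R P.Ring :=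
  hom_ext (by simp)

/-- Maps out of `R[X][Y]/⟨f, Yg − 1⟩` correspond bijectively to `x` with `f(x) = 0` and `g(x)`
invertible. [folklore] -/
@[simps]
def homEquiv : (P.Ring →ₐ[R] S) ≃ { x : S // P.HasMap x } where
  toFun φ := ⟨φ P.X, P.hasMap_X.map φ⟩
  invFun x := P.lift x.1 x.2
  left_inv φ := hom_ext (by simp)
  right_inv x := by simp

/-- Hensel step: a solution modulo a square-zero ideal lifts uniquely. [folklore] -/
theorem existsUnique_hasMap_of_hasMap_quotient_of_sq_eq_bot
    (I : Ideal S) (hI : I ^ 2 = ⊥) (x : S) (hx : P.HasMap (Ideal.Quotient.mk I x)) :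
    ∃! ε, ε ∈ I ∧ P.HasMap (x + ε) := by
  have hf := Ideal.Quotient.eq_zero_iff_mem.mp
    ((aeval_algHom_apply (Ideal.Quotient.mkₐ R I) _ _).symm.trans hx.1)
  obtain ⟨⟨_, a, ha, -⟩, rfl⟩ := hx.2
  obtain ⟨a, rfl⟩ := Ideal.Quotient.mk_surjective a
  simp_rw [← Ideal.Quotient.mkₐ_eq_mk R, aeval_algHom_apply, ← map_mul, ← map_one
    (Ideal.Quotient.mkₐ R I), Ideal.Quotient.mkₐ_eq_mk, Ideal.Quotient.mk_eq_mk_iff_sub_mem] at ha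
  obtain ⟨p₁, p₂, n, e⟩ := P.cond
  apply_fun aeval x at e
  simp only [map_add, map_mul, map_pow] at e
  obtain ⟨ε, hεI, b, hb⟩ : ∃ ε ∈ I, ∃ b, aeval x (derivative P.f) * b = 1 + ε := by
    refine ⟨_, ?_, (a ^ n * aeval x p₁), sub_eq_iff_eq_add'.mp rfl⟩
    convert_to (aeval x P.g * a) ^ n - 1 - aeval x P.f * (a ^ n * aeval x p₂) ∈ I
    · linear_combination a ^ n * e
    · exact sub_mem (Ideal.mem_of_dvd _ (sub_one_dvd_pow_sub_one _ _) ha) (I.mul_mem_right _ hf)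
  have : aeval x P.f ^ 2 = 0 := hI.le (Ideal.pow_mem_pow hf 2)
  have : aeval x P.f * ε = 0 := ((pow_two _).symm.trans hI).le (Ideal.mul_mem_mul hf hεI)
  refine ⟨aeval x P.f * -b, ⟨I.mul_mem_right _ hf, ?_, ?_⟩, ?_⟩
  · rw [Polynomial.aeval_add_of_sq_eq_zero _ _ _ (by grind)]; grind
  · rw [← IsNilpotent.isUnit_quotient_mk_iff (I := I) ⟨2, hI⟩, ← Ideal.Quotient.mkₐ_eq_mk R,
      ← aeval_algHom_apply, Ideal.Quotient.mkₐ_eq_mk, map_add,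
      Ideal.Quotient.eq_zero_iff_mem.mpr (I.mul_mem_right _ hf), add_zero]
    exact hx.2
  · rintro ε' ⟨hε'I, hε', hε''⟩
    rw [Polynomial.aeval_add_of_sq_eq_zero _ _ _ (hI.le (Ideal.pow_mem_pow hε'I 2))] at hε'
    have : ε * ε' = 0 := ((pow_two _).symm.trans hI).le (Ideal.mul_mem_mul hεI hε'I)
    grind

/-- `R[X][Y]/⟨f, Yg − 1⟩` is formally étale over `R` for ANY `f` (Mathlib's proof for
`StandardEtalePair`, which does not use monicity). [folklore] -/
instance formallyEtale : Algebra.FormallyEtale R P.Ring := by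
  refine Algebra.FormallyEtale.iff_comp_bijective.mpr fun S _ _ I hI ↦ ?_
  rw [← P.homEquiv.symm.bijective.of_comp_iff, ← P.homEquiv.bijective.of_comp_iff']
  suffices ∀ x, P.HasMap (Ideal.Quotient.mk I x) → ∃! a : { x : S // P.HasMap x }, a - x ∈ I by
    simpa [Function.bijective_iff_existsUnique, Ideal.Quotient.mk_surjective.forall,
      Subtype.ext_iff, Ideal.Quotient.mk_eq_mk_iff_sub_mem]
  intro x hx
  obtain ⟨ε, ⟨hεI, hε⟩, H⟩ := P.existsUnique_hasMap_of_hasMap_quotient_of_sq_eq_bot I hI _ hx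
  exact ⟨⟨x + ε, hε⟩, by simpa, fun y hy ↦
    Subtype.ext (sub_eq_iff_eq_add'.mp (H _ ⟨hy, by simpa using y.2⟩))⟩

/-- `R[X][Y]/⟨f, Yg − 1⟩` is étale over `R` for ANY `f` with `f′ p₁ + f p₂ = gⁿ` (Stacks Project,
Tag 00T7: standard smooth of relative dimension `0`). [folklore] -/
instance etale : Algebra.Etale R P.Ring where
  finitePresentation := by
    change Algebra.FinitePresentation R (R[X][Y] ⧸ Ideal.span {C P.f, Y * C P.g - 1})
    exact .quotient (Submodule.fg_span (by simp))

/-- Hence `P.Ring` is smooth over `R`. [folklore] -/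
instance smooth : Algebra.Smooth R P.Ring := inferInstance

/-! ### Constructors -/

/-- The étale pair `(f, f′)`: the algebra `(R[X]/f)[1/f′]`. [folklore] -/
@[simps]
def ofDerivative (f : R[X]) : EtalePair R where
  f := f
  g := derivative f
  cond := ⟨1, 0, 1, by simp⟩

/-- The étale pair `(f, f′·q)`: the algebra `(R[X]/f)[1/f′, 1/q]`. [folklore] -/
@[simps]
def ofDerivativeMul (f q : R[X]) : EtalePair R where
  f := f
  g := derivative f * q
  cond := ⟨q, 0, 1, by simp⟩

/-- For the pair `(f, f′·q)`: `HasMap x` iff `f(x) = 0`, `f′(x)` and `q(x)` are units.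
[folklore] -/
theorem hasMap_ofDerivativeMul_iff (f q : R[X]) (x : S) :
    (ofDerivativeMul f q).HasMap x ↔
      aeval x f = 0 ∧ IsUnit (aeval x (derivative f)) ∧ IsUnit (aeval x q) := by
  simp [HasMap, IsUnit.mul_iff]

end EtalePair

end Literature.AlgebraicGeometry.Resolution
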